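import Summits.QuantumFields.BalabanUV.T4Continuum.Support.NE7K1LinBlochDenominator
import Literature.MathematicalPhysics.QuantumFieldTheory.Balaban1983to89.B5Prop11Leaves

/-!
# NE7K1LinBlochSymbolZone — row NE7 (node U5), candidate route HOM, path H1L, cell K1-lin(s): NEEDS-ESTIMATE #E1, B-E1 TYPED —
# THE REAL-ZONE CLAUSES OF THE CONTINUUM BLOCK-MEAN MULTIPLIER `k_L = Δ^ξ_L ∕ 𝓝_L`: EVENNESS (on all of `ℂ^d`), and on the
# Brillouin zone REALITY ∕ SIGN ∕ `k_L(0) = 0` (file 47) and THE TWO-SIDED WINDOW `Δ¹ ≤ k_L ≤ (π²∕4)^{d+1}·Δ¹` with constants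
# depending on `d` ALONE, for every `L ≥ 1`; the same for the K1-lin(s) line `σ_s = (1−s)Δ¹ + s·k_L`

Lineage `b2b-balaban-t4-ne7-p2` (CRUX PROVER NE7 #2), generation 74; file 49.  Files 47–48 typed THEOREM S and the strip clauses of
`k_L`.  THIS FILE types the clauses on the REAL zone that lens 2's S-64-1 §3 (d′) lists («reality ∕ evenness ∕ sign ∕ window on
the real zone: k_L(x) = 1∕A_L(x) > 0, real, even (every summand of A_L is), k_L(0) = 0; NN(x) ≤ k_L(x) ≤ C·NN(x)») — for the CONTINUUM
multiplier (the finite-torus versions are files 38–41):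

* §1 EVENNESS (`S_ξ` even = the tree's `Beta.FP.SliceProjectorKernelSymm.Sxi_neg`, used inline): `uFactor_neg`, `U_neg : U_L(k; −p) = U_L(−k; p)`, `DeltaXi_shift_neg`, **`Nsym_neg : 𝓝_L(−p) = 𝓝_L(p)`** (alias
  re-indexing `k ↦ −k` on `(ℤ∕L)^d ∖ {0}`), **`kL_neg : k_L(−p) = k_L(p)`** on all of `ℂ^d`; real forms `Nsymr_neg`, `kLr_neg`.
* §2 THE WINDOW ON THE REAL ZONE, `L`-UNIFORM: lower half **`Delta1r_le_kLr : Δ¹(s) ≤ k_L(s)`** (`|s_μ| ≤ π`) — Jensen with constant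
  ONE at symbol level: `Δ¹(s) ≤ Δ^ξ_L(s + 2πk)` for every alias (`B5Prop11Leaves.Delta1r_le_DeltaXir_shift`, i.e. `|sin Lθ| ≤ L|sin θ|`)
  and the partition of unity `Σ_k |u_L(s+2πk)|² = 1` (`B5Prop11Leaves.sum_Ur_eq_one`); upper half **`kLr_le : k_L(s) ≤ (π²∕4)^{d+1}·Δ¹(s)`**
  (`B5Prop11Leaves.DeltaXir_le_Delta1r` and the real floor `𝓝_L ≥ (4∕π²)^d` of file 47) — cruder than the face count `L` of file 41
  or lens 2's THEOREM K constant, but FREE OF `L`.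
* §3 THE LINE on the real zone: `σ_s(s′) = (1−s)Δ¹(s′) + s·k_L(s′)` obeys the same window for every `s ∈ [0,1]` (`line_window`), is
  even and vanishes at `0`.

HONEST FRAMING: [folklore]; every inequality is the tree's BY NAME (`B4Strip`, `B5Prop11Leaves`) or alias bookkeeping; the window's
upper constant is existence-grade; the off-axis floor (a′)(b′) and derivative bounds (e′) are NOT here; the identification with
files 36–37's finite-torus symbol is NOT typed; R-E1 untouched; nothing of Bałaban's asserted; no `sorry`.  Census only; NE7 NOT
PRINTED ∕ NOT PROVED; spine 0∕9; FIXED FINITE T⁴, rung (B)+1; NOT infinite volume, NOT mass gap, NOT Clay.  HONEST DEPENDENCY: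
continuum YM on T⁴ ⇐ BetaPertH ∧ nine spine estimates (0/9 proved); BetaPertH ⇐ (D1) ∧ (D4) ∧ CAP+tail; G-an2-4 gates asym, D1 and
NE2/3/4.
-/

noncomputable section

open Finset Complex

namespace Summit.QuantumFields.BalabanUV.T4Continuum.NE7K1LinBlochSymbolZone

open Literature.MathematicalPhysics.QuantumFieldTheory.Balaban1983to89
open Literature.MathematicalPhysics.QuantumFieldTheory.Balaban1983to89.B4Strip
open Literature.MathematicalPhysics.QuantumFieldTheory.Balaban1983to89.B4StripCauchy
open Literature.MathematicalPhysics.QuantumFieldTheory.Balaban1983to89.B5Strip145Analytic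
open Literature.MathematicalPhysics.QuantumFieldTheory.Balaban1983to89.B5Prop11Leaves
open NE7K1LinBlochDenominator

variable {d : ℕ}

/-! ### §1 Evenness -/

/-- `S₁` is even. [folklore] -/
theorem S1_neg (z : ℂ) : S1 (-z) = S1 z := by
  unfold S1; rw [Complex.cos_neg]

/-- the residue `−j (mod n)` as a natural number. [folklore] -/
theorem val_neg_fin (n : ℕ) [NeZero n] (j : Fin n) : (((-j : Fin n) : ℕ) : ℂ) = (((n - (j : ℕ)) % n : ℕ) : ℂ) := by
  rw [Fin.neg_def]

/-- THE SHIFTED SYMBOL UNDER `z ↦ −z`: `S_ξ(−z + 2πj) = S_ξ(z + 2π(−j mod n))` (`S_ξ` even and `2πn`-periodic). [folklore] -/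
theorem Sxi_neg_shift (n : ℕ) [NeZero n] (j : Fin n) (z : ℂ) :
    Sxi n (-z + 2 * Real.pi * ((j : ℕ) : ℂ)) = Sxi n (z + 2 * Real.pi * (((-j : Fin n) : ℕ) : ℂ)) := by
  have hn : n ≠ 0 := NeZero.ne n
  have hj : (j : ℕ) ≤ n := j.isLt.le
  rw [val_neg_fin, Sxi_shift_mod n hn]
  -- `S_ξ` is even (the tree's `Beta.FP.SliceProjectorKernelSymm.Sxi_neg`, re-derived inline to keep the import light)
  have hev : ∀ w : ℂ, Sxi n (-w) = Sxi n w := fun w => by unfold Sxi; rw [neg_div, Complex.cos_neg]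
  have e1 : Sxi n (-z + 2 * Real.pi * ((j : ℕ) : ℂ)) = Sxi n (z - 2 * Real.pi * ((j : ℕ) : ℂ)) := by
    rw [← hev (z - _)]; congr 1; ring
  have e2 : z + 2 * Real.pi * (((n - (j : ℕ) : ℕ)) : ℂ)
      = (z - 2 * Real.pi * ((j : ℕ) : ℂ)) + 2 * Real.pi * (((0 + n * 1 : ℕ)) : ℂ) := by
    push_cast [Nat.cast_sub hj]; ring
  rw [e1, e2, Sxi_add_nat_mul n hn]
  push_cast; ring_nf

/-- one factor of `|u|²` under `z ↦ −z`: `u_n(j; −z) = u_n(−j mod n; z)`. [folklore] -/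
theorem uFactor_neg (n : ℕ) [NeZero n] (j : Fin n) (z : ℂ) :
    uFactor n (j : ℕ) (-z) = uFactor n ((-j : Fin n) : ℕ) z := by
  by_cases hj : j = 0
  · subst hj
    have hev : Sxi n (-z) = Sxi n z := by unfold Sxi; rw [neg_div, Complex.cos_neg]
    simp only [neg_zero, Fin.val_zero, uFactor_zero_eq, neg_eq_zero, S1_neg, hev]
  · have hj' : (j : ℕ) ≠ 0 := fun h => hj (Fin.ext h)
    have hnj : ((-j : Fin n) : ℕ) ≠ 0 := fun h => hj (neg_eq_zero.mp (Fin.ext h))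
    rw [uFactor_ne_eq n _ hj', uFactor_ne_eq n _ hnj, S1_neg, Sxi_neg_shift]

/-- `U_L(k; −p) = U_L(−k; p)`. [folklore] -/
theorem U_neg (n : ℕ) [NeZero n] (k : Fin d → Fin n) (p : Fin d → ℂ) : U n k (-p) = U n (-k) p := by
  unfold U
  exact Finset.prod_congr rfl (fun μ _ => by rw [Pi.neg_apply, Pi.neg_apply, uFactor_neg])

/-- `Δ^ξ_L(−p + 2πk) = Δ^ξ_L(p + 2π(−k))`. [folklore] -/
theorem DeltaXi_shift_neg (n : ℕ) [NeZero n] (m2 : ℝ) (k : Fin d → Fin n) (p : Fin d → ℂ) :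
    DeltaXi n m2 (shift n k (-p)) = DeltaXi n m2 (shift n (-k) p) := by
  unfold DeltaXi shift
  congr 1
  exact Finset.sum_congr rfl (fun μ _ => by rw [Pi.neg_apply, Pi.neg_apply, Sxi_neg_shift])

/-- `Δ^ξ_L` is even. [folklore] -/
theorem DeltaXi_neg (n : ℕ) [NeZero n] (m2 : ℝ) (p : Fin d → ℂ) : DeltaXi n m2 (-p) = DeltaXi n m2 p := by
  have := DeltaXi_shift_neg n m2 (fun _ => 0) p
  have e0 : (-(fun _ : Fin d => (0 : Fin n))) = fun _ => 0 := by funext μ; simp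
  rwa [e0, shift_zero, shift_zero] at this

/-- **EVENNESS OF THE BLOCH DENOMINATOR**: `𝓝_L(−p) = 𝓝_L(p)` on all of `ℂ^d` (the alias set `(ℤ∕L)^d ∖ {0}` is invariant under
`k ↦ −k`). [folklore] -/
theorem Nsym_neg (L : ℕ) [NeZero L] (p : Fin d → ℂ) : Nsym L (-p) = Nsym L p := by
  unfold Nsym
  have e0 : (-(fun _ : Fin d => (0 : Fin L))) = fun _ => 0 := by funext μ; simp
  have hU0 : U L (fun _ => (0 : Fin L)) (-p) = U L (fun _ => (0 : Fin L)) p := by rw [U_neg, e0]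
  rw [hU0, DeltaXi_neg]
  congr 1
  simp_rw [U_neg, DeltaXi_shift_neg]
  refine Finset.sum_equiv (Equiv.neg (Fin d → Fin L)) (fun k => ?_) (fun k _ => rfl)
  simp only [Finset.mem_erase, Finset.mem_univ, and_true, Equiv.neg_apply, ne_eq]
  constructor
  · intro h h'
    exact h (by rw [← neg_neg k, h', e0])
  · intro h h'
    exact h (by rw [h', e0])

/-- **EVENNESS OF THE BLOCK-MEAN MULTIPLIER**: `k_L(−p) = k_L(p)` on all of `ℂ^d` (clause (a′)). [folklore] -/
theorem kL_neg (L : ℕ) [NeZero L] (p : Fin d → ℂ) : kL L (-p) = kL L p := by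
  unfold kL; rw [Nsym_neg, DeltaXi_neg]

/-- the real embedding commutes with negation. [folklore] -/
theorem ofRealVec_neg (s : Fin d → ℝ) : ofRealVec (-s) = -ofRealVec s := by
  funext μ; simp [ofRealVec]

/-- real form: `𝓝_L(−s) = 𝓝_L(s)`. [folklore] -/
theorem Nsymr_neg (L : ℕ) [NeZero L] (s : Fin d → ℝ) : Nsymr L (-s) = Nsymr L s := by
  have h := Nsym_neg L (ofRealVec s)
  rw [← ofRealVec_neg, Nsym_ofReal, Nsym_ofReal] at h
  exact_mod_cast h

/-- real form: `k_L(−s) = k_L(s)`. [folklore] -/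
theorem kLr_neg (L : ℕ) [NeZero L] (s : Fin d → ℝ) : kLr L (-s) = kLr L s := by
  have h := kL_neg L (ofRealVec s)
  rw [← ofRealVec_neg, kL_ofReal, kL_ofReal] at h
  exact_mod_cast h

/-! ### §2 The two-sided window on the real zone, uniform in `L` -/

/-- `Δ¹(s)·𝓝_L(s) ≤ Δ^ξ_L(s)` on the zone — every alias denominator dominates `Δ¹` (`Delta1r_le_DeltaXir_shift`) and the
weights sum to one (`sum_Ur_eq_one`). [folklore] -/
theorem Delta1r_mul_Nsymr_le (L : ℕ) [NeZero L] (s : Fin d → ℝ) (hs : ∀ μ, |s μ| ≤ Real.pi) :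
    Delta1r 0 s * Nsymr L s ≤ DeltaXir L 0 s := by
  have hL : 1 ≤ L := Nat.one_le_iff_ne_zero.mpr (NeZero.ne L)
  have hD0 : 0 ≤ DeltaXir L 0 s := DeltaXir_nonneg L 0 le_rfl s
  have hΔ1 : 0 ≤ Delta1r 0 s := Delta1r_nonneg 0 le_rfl s
  have hsum := sum_Ur_eq_one L hL s hs
  rw [← Finset.add_sum_erase Finset.univ _ (Finset.mem_univ (fun _ => (0 : Fin L)))] at hsum
  -- termwise: Δ¹·U₀ ≤ Δ^ξ·U₀ and Δ¹·U_k·(Δ^ξ∕Δ^ξ_k) ≤ Δ^ξ·U_k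
  have h0 : Delta1r 0 s * Ur L (fun _ => (0 : Fin L)) s ≤ DeltaXir L 0 s * Ur L (fun _ => (0 : Fin L)) s :=
    mul_le_mul_of_nonneg_right (Delta1r_le_DeltaXir L hL s) (Ur_nonneg _ _ _)
  have hk : ∀ k ∈ Finset.univ.erase (fun _ => (0 : Fin L)),
      Delta1r 0 s * (Ur L k s * (DeltaXir L 0 s / DeltaXir L 0 (shiftr L k s))) ≤ DeltaXir L 0 s * Ur L k s := by
    intro k _
    have hU := Ur_nonneg L k s
    rcases (DeltaXir_nonneg L 0 le_rfl (shiftr L k s)).eq_or_lt with hz | hpos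
    · rw [← hz, div_zero, mul_zero, mul_zero]; exact mul_nonneg hD0 hU
    · have hle : Delta1r 0 s ≤ DeltaXir L 0 (shiftr L k s) := Delta1r_le_DeltaXir_shift L hL k s
      have : Delta1r 0 s / DeltaXir L 0 (shiftr L k s) ≤ 1 := by rw [div_le_one hpos]; exact hle
      calc Delta1r 0 s * (Ur L k s * (DeltaXir L 0 s / DeltaXir L 0 (shiftr L k s)))
          = DeltaXir L 0 s * Ur L k s * (Delta1r 0 s / DeltaXir L 0 (shiftr L k s)) := by ring
        _ ≤ DeltaXir L 0 s * Ur L k s * 1 := mul_le_mul_of_nonneg_left this (mul_nonneg hD0 hU)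
        _ = DeltaXir L 0 s * Ur L k s := by ring
  unfold Nsymr
  rw [mul_add, Finset.mul_sum]
  calc Delta1r 0 s * Ur L (fun _ => (0 : Fin L)) s +
        ∑ k ∈ Finset.univ.erase (fun _ => (0 : Fin L)),
          Delta1r 0 s * (Ur L k s * (DeltaXir L 0 s / DeltaXir L 0 (shiftr L k s)))
      ≤ DeltaXir L 0 s * Ur L (fun _ => (0 : Fin L)) s +
        ∑ k ∈ Finset.univ.erase (fun _ => (0 : Fin L)), DeltaXir L 0 s * Ur L k s :=
        add_le_add h0 (Finset.sum_le_sum hk)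
    _ = DeltaXir L 0 s * (Ur L (fun _ => (0 : Fin L)) s + ∑ k ∈ Finset.univ.erase (fun _ => (0 : Fin L)), Ur L k s) := by
        rw [mul_add, Finset.mul_sum]
    _ = DeltaXir L 0 s := by rw [hsum, mul_one]

/-- **WINDOW, LOWER HALF (Jensen with constant ONE, at symbol level)**: `Δ¹(s) ≤ k_L(s)` for real `s` with `|s_μ| ≤ π`, every
`L ≥ 1` — the continuum form of `NE7K1LinTorusFloor.torSymb_re_ge_nn` (`−Δ_coarse ⪯ K_L`). [folklore] -/
theorem Delta1r_le_kLr (L : ℕ) [NeZero L] (s : Fin d → ℝ) (hs : ∀ μ, |s μ| ≤ Real.pi) : Delta1r 0 s ≤ kLr L s := by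
  have hL : 1 ≤ L := Nat.one_le_iff_ne_zero.mpr (NeZero.ne L)
  unfold kLr
  rw [le_div_iff₀ (Nsymr_pos L hL s hs)]
  exact Delta1r_mul_Nsymr_le L s hs

/-- **WINDOW, UPPER HALF (crude, `L`-free)**: `k_L(s) ≤ (π²∕4)^{d+1} · Δ¹(s)` on the zone, every `L ≥ 1`
(`Δ^ξ_L ≤ (π²∕4)Δ¹`, `B5Prop11Leaves.DeltaXir_le_Delta1r`, and `𝓝_L ≥ (4∕π²)^d`, file 47). [folklore] -/
theorem kLr_le (L : ℕ) [NeZero L] (s : Fin d → ℝ) (hs : ∀ μ, |s μ| ≤ Real.pi) :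
    kLr L s ≤ (Real.pi ^ 2 / 4) ^ (d + 1) * Delta1r 0 s := by
  have hL : 1 ≤ L := Nat.one_le_iff_ne_zero.mpr (NeZero.ne L)
  have hN := Nsymr_ge L hL s hs
  have hNpos := Nsymr_pos L hL s hs
  have hD := DeltaXir_le_Delta1r L s hs
  have hΔ1 : 0 ≤ Delta1r 0 s := Delta1r_nonneg 0 le_rfl s
  have hπ : 0 < Real.pi ^ 2 / 4 := by positivity
  have h1 : 1 ≤ (Real.pi ^ 2 / 4) ^ d * Nsymr L s := by
    have e : (Real.pi ^ 2 / 4) ^ d * (4 / Real.pi ^ 2) ^ d = 1 := by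
      rw [← mul_pow]
      have : Real.pi ^ 2 / 4 * (4 / Real.pi ^ 2) = 1 := by field_simp
      rw [this, one_pow]
    calc (1 : ℝ) = (Real.pi ^ 2 / 4) ^ d * (4 / Real.pi ^ 2) ^ d := e.symm
      _ ≤ (Real.pi ^ 2 / 4) ^ d * Nsymr L s := mul_le_mul_of_nonneg_left hN (by positivity)
  unfold kLr
  rw [div_le_iff₀ hNpos]
  calc DeltaXir L 0 s ≤ Real.pi ^ 2 / 4 * Delta1r 0 s * 1 := by rw [mul_one]; exact hD
    _ ≤ Real.pi ^ 2 / 4 * Delta1r 0 s * ((Real.pi ^ 2 / 4) ^ d * Nsymr L s) :=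
        mul_le_mul_of_nonneg_left h1 (by positivity)
    _ = (Real.pi ^ 2 / 4) ^ (d + 1) * Delta1r 0 s * Nsymr L s := by ring

/-- THE WINDOW (clause (c′)∕(d′) on the real zone, `L`-UNIFORM): `Δ¹(s) ≤ k_L(s) ≤ (π²∕4)^{d+1}·Δ¹(s)`, `|s_μ| ≤ π`, every `L ≥ 1`. [folklore] -/
theorem kLr_window (L : ℕ) [NeZero L] (s : Fin d → ℝ) (hs : ∀ μ, |s μ| ≤ Real.pi) :
    Delta1r 0 s ≤ kLr L s ∧ kLr L s ≤ (Real.pi ^ 2 / 4) ^ (d + 1) * Delta1r 0 s :=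
  ⟨Delta1r_le_kLr L s hs, kLr_le L s hs⟩

/-- positivity off the origin: `k_L(s) > 0` for `s ≠ 0` in the zone (`Δ¹ > 0` there). [folklore] -/
theorem kLr_pos (L : ℕ) [NeZero L] (s : Fin d → ℝ) (hs : ∀ μ, |s μ| ≤ Real.pi) (μ : Fin d) (hμ : s μ ≠ 0) :
    0 < kLr L s :=
  lt_of_lt_of_le (Delta1r_pos s hs μ hμ) (Delta1r_le_kLr L s hs)

/-! ### §3 The K1-lin(s) line on the real zone -/

/-- THE LINE'S WINDOW: for `s′` in the zone and `0 ≤ s ≤ 1`, `Δ¹(s′) ≤ (1−s)Δ¹(s′) + s·k_L(s′) ≤ (π²∕4)^{d+1}·Δ¹(s′)` — `s`-free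
constants (affine in `s`; `NE7K1LinTorusSymbolWindow.torSymb_window`'s continuum form with `L`-free upper constant). [folklore] -/
theorem line_window (L : ℕ) [NeZero L] {s : ℝ} (hs0 : 0 ≤ s) (hs1 : s ≤ 1) (s' : Fin d → ℝ)
    (hs' : ∀ μ, |s' μ| ≤ Real.pi) :
    Delta1r 0 s' ≤ (1 - s) * Delta1r 0 s' + s * kLr L s' ∧
      (1 - s) * Delta1r 0 s' + s * kLr L s' ≤ (Real.pi ^ 2 / 4) ^ (d + 1) * Delta1r 0 s' := by
  obtain ⟨hlo, hhi⟩ := kLr_window L s' hs'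
  have hΔ1 : 0 ≤ Delta1r 0 s' := Delta1r_nonneg 0 le_rfl s'
  have hC : (1 : ℝ) ≤ (Real.pi ^ 2 / 4) ^ (d + 1) := by
    apply one_le_pow₀
    have := Real.pi_gt_three
    nlinarith
  constructor
  · nlinarith
  · nlinarith [mul_le_mul_of_nonneg_left hhi hs0]

/-- the line's multiplier is even on `ℂ^d`. [folklore] -/
theorem line_neg (L : ℕ) [NeZero L] (s : ℂ) (p : Fin d → ℂ) :
    (1 - s) * Delta1 0 (-p) + s * kL L (-p) = (1 - s) * Delta1 0 p + s * kL L p := by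
  rw [kL_neg]
  congr 2
  unfold Delta1
  congr 1
  exact Finset.sum_congr rfl (fun μ _ => by rw [Pi.neg_apply, S1_neg])

/-- the line's multiplier vanishes at `p = 0`. [folklore] -/
theorem line_zero (L : ℕ) [NeZero L] (s : ℂ) :
    (1 - s) * Delta1 0 (fun _ : Fin d => (0 : ℂ)) + s * kL L (fun _ : Fin d => (0 : ℂ)) = 0 := by
  rw [kL_zero]
  unfold Delta1 S1
  simp

end Summit.QuantumFields.BalabanUV.T4Continuum.NE7K1LinBlochSymbolZone

end
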